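/- Copyright: the b2b-balaban cell (near-miss cell 7), T⁴-continuum fan-out, NE7b swarm leaf 04 (gen 7; road W-RP, sub-row
«W3o» file 3: the uniform box templates satisfy BOTH template hypotheses of file 1 — non-vacuity by the natural
small∕large-field templates).  Released under the licence of the surrounding project. -/
import Summits.QuantumFields.BalabanUV.T4Continuum.Support.HistoryRPTowerTemplates
import Summits.QuantumFields.BalabanUV.T4Continuum.Support.HistoryRPTowerColumns

/-!
# History chessboard road: UNIFORM BOX TEMPLATES — `tmpl_meas` and `tmpl_sym` hold together (W3o, file 3)

Summits-side support leaf of the T⁴-continuum cell (rung (B)+1 on a FINITE torus only; NOT infinite volume, NOT the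
mass gap, NOT the Clay statement; NOT a proof of the spine estimate NE7b).  Road W-RP (R-OWNER-23-2 ∕ R-OWNER-23-8) of
the swarm claim table `t4/b2b-balaban-t4-ne7b-p1/LEAVES-NE7b.md`, sub-row «W3o» file 3, on top of file 1
(`HistoryRPTowerTemplates`: `boxBonds`, `boxAlg`, `towerBox`, the template hypotheses of `tEvent_loc` ∕ `tEvent_sym`) and
leaf-07 g5's W3n file 1 (`HistoryRPTowerColumns`: `sref`, `cutBond_src∕tgt_of_ne∕eq`, consumed BY NAME).  [folklore]
bookkeeping; DATA defs `boxUniform`, `axisVec`; no `structure`, no `[cite:]` tag, no `Prop`-valued definition (c1), no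
constant (c2∕c6), no exit ∕ socket ∕ `HistoryConstants` file (c3); nothing printed asserted.

WHY.  File 1 turns W4b′∕W4c's `E_meas` ∕ `loc` ∕ `sym` into theorems for template events under TWO hypotheses on the
template: reference-column measurability (`MeasurableSet[towerBox G K M K] tmpl`) and the one-set reflection symmetry per
axis (`(towerRefl i K)⁻¹' tmpl = (towerTranslate K (−M·e_i))⁻¹' tmpl`).  This file shows they hold TOGETHER for the
natural template «every bond of the reference column carries a value in `A`», `A ⊆ G` measurable and inversion-symmetric
— e.g. `A := {g | dist1 g < ε}` (small field throughout the column; `GaugeGroup.dist1_inv`) or, by complements, «a large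
bond somewhere in the column»: the hypotheses of file 1 are not vacuous and are met by the shape of Bałaban's small∕large
field conditions per bond (which template models HIS terms stays the (EXT) reading).

WHAT.
* §1 `boxUniform P G A K M k` (recursion as `towerBox`), **`measurableSet_boxUniform`** (`tmpl_meas`).
* §2 `axisVec P j i s` (`s·e_i`), `scale_axisVec` (pv07's `scale_update`), `neg_axisVec_one` (`−e_i` = the tree's
  `(0 : Site).unshift i`), `val_add_natCast_lt_iff`, `val_sref_zero_lt_iff`, `cbond_eq_cutBond_zero`,
  **`cbond_mem_boxBonds_iff`** (the centre reflection carries the box to the mirror box: `cbond i b ∈ boxBonds P j s ↔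
  b.translate (s·e_i) ∈ boxBonds P j s`), **`preimage_creflect_boxSet`** (one level), `sitesPerDir_eq_mul_pow`,
  **`preimage_towerRefl_boxUniform`** (every level), **`boxUniform_sym`** (top cube of side `M ≤ N_K`: mirror vector
  `−M·e_i`), **`boxUniform_sym_cell`** (`M = 1`: file 1's `tEvent_sym` hypothesis VERBATIM).

HONEST SCOPE.  Non-vacuity of OUR template hypotheses on OUR carriers; discharges nothing of (EXT) ∕ (U1) ∕ (G2) ∕ H3 ∕
(B) ∕ BetaPertH; NE7b NOT proved; spine 0∕9.  HONEST DEPENDENCY (cell): continuum YM on T⁴ ⇐ BetaPertH ∧ nine spine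
estimates (0/9 proved); BetaPertH ⇐ (D1) ∧ (D4) ∧ CAP+tail; G-an2-4 gates asym, D1 and NE2/3/4.  This file changes none of
it. -/

open MeasureTheory
open Literature.MathematicalPhysics.QuantumFieldTheory
open Literature.MathematicalPhysics.QuantumFieldTheory.Balaban1983to89
open T4UndoubledRP
open Summit.QuantumFields.BalabanUV.T4Continuum.HistoryRPHalfTorus
open Summit.QuantumFields.BalabanUV.T4Continuum.HistoryRPTowerLaw
open Summit.QuantumFields.BalabanUV.T4Continuum.HistoryRPTowerCuts
open Summit.QuantumFields.BalabanUV.T4Continuum.HistoryRPTowerCells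
open Summit.QuantumFields.BalabanUV.T4Continuum.HistoryRPTowerTemplates
open Summit.QuantumFields.BalabanUV.T4Continuum.HistoryRPTowerColumns

namespace Summit.QuantumFields.BalabanUV.T4Continuum.HistoryRPTowerUniform

noncomputable section

variable {P : Params} {G : Type*}

/-! ## §1 The uniform box template and its reference-column measurability -/

variable (P G)

/-- **THE UNIFORM BOX TEMPLATE**: every bond of the reference column (box of side `M·L^{K−k'}` at every level `k' ≤ k`)
carries a value in `A` (recursion as `towerBox`).  `A := {g | dist1 g < ε}`: «small field throughout the column»; its
complement: «a large bond somewhere in the column». -/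
def boxUniform (A : Set G) (K M : ℕ) : (k : ℕ) → Set (Tower P G k)
  | 0 => {U | ∀ b ∈ boxBonds P 0 (M * P.L ^ (K - 0)), U b ∈ A}
  | k + 1 => {ω | ω.1 ∈ boxUniform A K M k ∧ ∀ b ∈ boxBonds P (k + 1) (M * P.L ^ (K - (k + 1))), ω.2 b ∈ A}

variable {P G}

/-- `tmpl_meas` FOR THE UNIFORM BOX TEMPLATE (measurable `A`). [folklore] -/
theorem measurableSet_boxUniform [MeasurableSpace G] {A : Set G} (hA : MeasurableSet A) (K M : ℕ) :
    ∀ k : ℕ, MeasurableSet[towerBox (P := P) G K M k] (boxUniform P G A K M k)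
  | 0 => by
    show MeasurableSet[boxAlg G 0 (M * P.L ^ (K - 0))] {U : GaugeField P 0 G | ∀ b ∈ boxBonds P 0 _, U b ∈ A}
    have : {U : GaugeField P 0 G | ∀ b ∈ boxBonds P 0 (M * P.L ^ (K - 0)), U b ∈ A} =
        ⋂ b ∈ boxBonds P 0 (M * P.L ^ (K - 0)), {U | U b ∈ A} := by
      ext U
      simp only [Set.mem_setOf_eq, Set.mem_iInter]
    rw [this]
    exact MeasurableSet.biInter (Finset.countable_toSet _) fun b hb => measurable_coord_boxAlg hb hA
  | k + 1 => by
    have h1 : MeasurableSet[towerBox G K M (k + 1)] {ω : Tower P G (k + 1) | ω.1 ∈ boxUniform P G A K M k} :=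
      (measurable_fst_towerBox K M k) (measurableSet_boxUniform hA K M k)
    have h2 : MeasurableSet[towerBox G K M (k + 1)]
        {ω : Tower P G (k + 1) | ∀ b ∈ boxBonds P (k + 1) (M * P.L ^ (K - (k + 1))), ω.2 b ∈ A} := by
      have : {ω : Tower P G (k + 1) | ∀ b ∈ boxBonds P (k + 1) (M * P.L ^ (K - (k + 1))), ω.2 b ∈ A} =
          ⋂ b ∈ boxBonds P (k + 1) (M * P.L ^ (K - (k + 1))), {ω : Tower P G (k + 1) | ω.2 b ∈ A} := by
        ext ω
        simp only [Set.mem_setOf_eq, Set.mem_iInter]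
      rw [this]
      exact MeasurableSet.biInter (Finset.countable_toSet _) fun b hb =>
        ((measurable_coord_boxAlg hb).comp (measurable_snd_towerBox K M k)) hA
    show MeasurableSet[towerBox G K M (k + 1)] ({ω : Tower P G (k + 1) | ω.1 ∈ boxUniform P G A K M k} ∩
      {ω : Tower P G (k + 1) | ∀ b ∈ boxBonds P (k + 1) (M * P.L ^ (K - (k + 1))), ω.2 b ∈ A})
    exact h1.inter h2

/-! ## §2 The reflection symmetry of the uniform box template -/

/-- the vector `s·e_i` at level `j` (`Function.update 0 i s`, the letter of pv07's `scale_update`). -/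
def axisVec (P : Params) (j : ℕ) (i : Fin P.d) (s : ℕ) : Site P j :=
  Function.update (0 : Site P j) i (s : ZMod (P.sitesPerDir j))

/-- `axisVec` evaluated. [folklore] -/
theorem axisVec_apply (j : ℕ) (i : Fin P.d) (s : ℕ) (μ : Fin P.d) :
    axisVec P j i s μ = if μ = i then (s : ZMod (P.sitesPerDir j)) else 0 := by
  simp only [axisVec, Function.update_apply, Site.zero_apply]

/-- one level down, `s·e_i` scales to `(s·L)·e_i` (pv07's `scale_update`). [folklore] -/
theorem scale_axisVec (j : ℕ) (i : Fin P.d) (s : ℕ) : Site.scale (axisVec P (j + 1) i s) = axisVec P j i (s * P.L) :=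
  scale_update s i

/-- `−1·e_i = −e_i` in the tree's letter `(0 : Site).unshift i` of `GaugeField.creflect`. [folklore] -/
theorem neg_axisVec_one (j : ℕ) (i : Fin P.d) : -axisVec P j i 1 = (0 : Site P j).unshift i := by
  funext μ
  rw [site_neg_apply, axisVec_apply, Site.unshift_apply, Site.zero_apply, Site.zero_apply]
  split_ifs <;> simp

/-- a label shifted by `s ≤ N` lands below `s` iff it was at least `N − s`. [folklore] -/
theorem val_add_natCast_lt_iff {N : ℕ} [NeZero N] {s : ℕ} (hs : s ≤ N) (x : ZMod N) :
    (x + (s : ZMod N)).val < s ↔ N ≤ x.val + s := by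
  have hx := ZMod.val_lt x
  rcases hs.eq_or_lt with h | h
  · subst h
    simp only [ZMod.natCast_self, add_zero]
    omega
  · have hsval : ((s : ZMod N)).val = s := by rw [ZMod.val_natCast, Nat.mod_eq_of_lt h]
    rw [ZMod.val_add, hsval]
    rcases Nat.lt_or_ge (x.val + s) N with h1 | h1
    · rw [Nat.mod_eq_of_lt h1]; omega
    · rw [Nat.mod_eq_sub_mod h1, Nat.mod_eq_of_lt (by omega)]; omega

/-- the centre-reflected label: `(2·0 − 1 − x).val < s ↔ N ≤ x.val + s` (`val_neg_sub_one`). [folklore] -/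
theorem val_sref_zero_lt_iff {j : ℕ} {s : ℕ} (i : Fin P.d) (y : Site P j) :
    (sref j i 0 y i).val < s ↔ P.sitesPerDir j ≤ (y i).val + s := by
  rw [sref_apply_same, mul_zero, zero_sub, show (-1 - y i) = -(y i) - 1 by ring, AveragingReflection.val_neg_sub_one]
  have hx := ZMod.val_lt (y i)
  omega

/-- `cbond` is `cutBond` at the centre cut `k = 0`. [folklore] -/
theorem cbond_eq_cutBond_zero {j : ℕ} (i : Fin P.d) (b : PBond P j) : cbond i b = cutBond i (cutVec j i 0) b := by
  have e0 : cutVec j i (0 : ZMod (P.sitesPerDir j)) = 0 := Pi.single_zero i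
  rw [e0, cutBond, neg_zero, pbond_translate_zero, pbond_translate_zero]

/-- **THE CENTRE REFLECTION CARRIES THE BOX TO THE MIRROR BOX**: `cbond i b ∈ boxBonds P j s ↔
b.translate (s·e_i) ∈ boxBonds P j s` (`s ≤ N_j`; W3n's `cutBond_src∕tgt_of_ne∕eq` at the centre cut). [folklore] -/
theorem cbond_mem_boxBonds_iff {j : ℕ} (i : Fin P.d) {s : ℕ} (hs : s ≤ P.sitesPerDir j) (b : PBond P j) :
    cbond i b ∈ boxBonds P j s ↔ b.translate (axisVec P j i s) ∈ boxBonds P j s := by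
  have hsrc : ∀ μ, ((b.translate (axisVec P j i s)).src μ) = b.src μ + axisVec P j i s μ := fun μ => rfl
  have htgt : ∀ μ, ((b.translate (axisVec P j i s)).tgt μ) = b.tgt μ + axisVec P j i s μ := by
    intro μ
    show ((b.src + axisVec P j i s).shift b.dir) μ = _
    rw [Site.shift_add]; rfl
  have htgt_of_ne : ∀ {μ}, μ ≠ b.dir → b.tgt μ = b.src μ := by
    intro μ hμ
    show (b.src.shift b.dir) μ = b.src μ
    rw [Site.shift_apply, if_neg hμ]
  rw [mem_boxBonds, mem_boxBonds, cbond_eq_cutBond_zero]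
  refine forall_congr' fun μ => ?_
  rw [hsrc, htgt, axisVec_apply]
  by_cases hd : b.dir = i
  · rw [cutBond_src_of_eq i 0 b hd, cutBond_tgt_of_eq i 0 b hd]
    by_cases hμ : μ = i
    · subst hμ
      rw [if_pos rfl, val_sref_zero_lt_iff, val_sref_zero_lt_iff, val_add_natCast_lt_iff hs,
        val_add_natCast_lt_iff hs, and_comm]
    · rw [if_neg hμ, add_zero, add_zero, sref_apply_of_ne i 0 _ hμ, sref_apply_of_ne i 0 _ hμ, and_comm]
  · rw [cutBond_src_of_ne i 0 b hd, cutBond_tgt_of_ne i 0 b hd]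
    by_cases hμ : μ = i
    · subst hμ
      rw [if_pos rfl, val_sref_zero_lt_iff, val_sref_zero_lt_iff, val_add_natCast_lt_iff hs,
        val_add_natCast_lt_iff hs]
    · rw [if_neg hμ, add_zero, add_zero, sref_apply_of_ne i 0 _ hμ, sref_apply_of_ne i 0 _ hμ]

variable [GaugeGroup G]

/-- **ONE LEVEL**: for an inversion-symmetric `A`, the uniform box set pulled back by the centre reflection equals its
pull-back by the translation to the mirror box (`s ≤ N_j`). [folklore] -/
theorem preimage_creflect_boxSet {j : ℕ} {A : Set G} (hA : ∀ g : G, g⁻¹ ∈ A ↔ g ∈ A) (i : Fin P.d) {s : ℕ}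
    (hs : s ≤ P.sitesPerDir j) :
    (GaugeField.creflect (P := P) (G := G) i) ⁻¹' {U | ∀ b ∈ boxBonds P j s, U b ∈ A} =
      (GaugeField.translate (-axisVec P j i s)) ⁻¹' {U | ∀ b ∈ boxBonds P j s, U b ∈ A} := by
  ext U
  simp only [Set.mem_preimage, Set.mem_setOf_eq, creflect_apply, GaugeField.translate_apply]
  constructor
  · intro h b hb
    have hc : cbond i (b.translate (-axisVec P j i s)) ∈ boxBonds P j s := by
      rw [cbond_mem_boxBonds_iff i hs, PBond.translate_translate, neg_add_cancel, pbond_translate_zero]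
      exact hb
    have h' := h _ hc
    rw [cbond_cbond, cbond_dir, PBond.translate_dir] at h'
    split_ifs at h' with hd
    · exact (hA _).1 h'
    · exact h'
  · intro h b hb
    have hc : (cbond i b).translate (axisVec P j i s) ∈ boxBonds P j s := by
      rw [← cbond_mem_boxBonds_iff i hs, cbond_cbond]
      exact hb
    have h' := h _ hc
    rw [PBond.translate_translate, add_neg_cancel, pbond_translate_zero] at h'
    split_ifs with hd
    · exact (hA _).2 h'
    · exact h'

/-- the box sides fit the tori: `N_k = N_K · L^{K−k}` for `k ≤ K ≤ m + P.K`. [folklore] -/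
theorem sitesPerDir_eq_mul_pow {k K : ℕ} (hk : k ≤ K) (hK : K ≤ P.m + P.K) :
    P.sitesPerDir k = P.sitesPerDir K * P.L ^ (K - k) := by
  unfold Params.sitesPerDir
  rw [mul_assoc, ← pow_add]
  congr 2
  omega

/-- **`tmpl_sym` FOR THE UNIFORM BOX TEMPLATE** (every level `k ≤ K`; the mirror vector at level `k` is
`−M·L^{K−k}·e_i`; `A` inversion-symmetric, the top cube inside the torus: `M ≤ N_K`). [folklore] -/
theorem preimage_towerRefl_boxUniform {A : Set G} (hA : ∀ g : G, g⁻¹ ∈ A ↔ g ∈ A) (i : Fin P.d) (K M : ℕ)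
    (hM : M ≤ P.sitesPerDir K) (hK : K ≤ P.m + P.K) :
    ∀ k : ℕ, k ≤ K → (towerRefl i k) ⁻¹' boxUniform P G A K M k =
      (towerTranslate k (-axisVec P k i (M * P.L ^ (K - k)))) ⁻¹' boxUniform P G A K M k
  | 0, hk => preimage_creflect_boxSet hA i (by
      rw [sitesPerDir_eq_mul_pow hk hK]; exact Nat.mul_le_mul_right _ hM)
  | k + 1, hk => by
    have hs : M * P.L ^ (K - (k + 1)) ≤ P.sitesPerDir (k + 1) := by
      rw [sitesPerDir_eq_mul_pow hk hK]; exact Nat.mul_le_mul_right _ hM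
    have ih := preimage_towerRefl_boxUniform hA i K M hM hK k (Nat.le_of_succ_le hk)
    have h1 := preimage_creflect_boxSet (P := P) (G := G) hA i hs
    ext ω
    obtain ⟨ω', V⟩ := ω
    have e1 := Set.ext_iff.1 ih ω'
    have e2 := Set.ext_iff.1 h1 V
    simp only [Set.mem_preimage, Set.mem_setOf_eq] at e1 e2
    have hsc : Site.scale (-axisVec P (k + 1) i (M * P.L ^ (K - (k + 1)))) = -axisVec P k i (M * P.L ^ (K - k)) := by
      rw [map_neg, scale_axisVec, mul_assoc, ← pow_succ, show K - (k + 1) + 1 = K - k by omega]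
    show (towerRefl i k ω' ∈ boxUniform P G A K M k ∧
        ∀ b ∈ boxBonds P (k + 1) (M * P.L ^ (K - (k + 1))), GaugeField.creflect i V b ∈ A) ↔
      (towerTranslate k (Site.scale (-axisVec P (k + 1) i (M * P.L ^ (K - (k + 1))))) ω' ∈ boxUniform P G A K M k ∧
        ∀ b ∈ boxBonds P (k + 1) (M * P.L ^ (K - (k + 1))),
          GaugeField.translate (-axisVec P (k + 1) i (M * P.L ^ (K - (k + 1)))) V b ∈ A)
    rw [hsc]
    exact and_congr e1 e2

/-- **AT THE TOP**: the uniform box template of a tower of height `K ≤ m + P.K` has the reflection symmetry of every axis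
with mirror vector `−M·e_i` (the mirror CUBE; `M ≤ N_K`). [folklore] -/
theorem boxUniform_sym {A : Set G} (hA : ∀ g : G, g⁻¹ ∈ A ↔ g ∈ A) {K M : ℕ} (hM : M ≤ P.sitesPerDir K)
    (hK : K ≤ P.m + P.K) (i : Fin P.d) :
    (towerRefl i K) ⁻¹' boxUniform P G A K M K = (towerTranslate K (-axisVec P K i M)) ⁻¹' boxUniform P G A K M K := by
  have h := preimage_towerRefl_boxUniform (P := P) (G := G) hA i K M hM hK K le_rfl
  rwa [Nat.sub_self, pow_zero, mul_one] at h

/-- **… UNIT CELLS** (`M = 1`): the mirror vector is the tree's `−e_i = (0 : Site P K).unshift i` — exactly W3o's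
`tEvent_sym` hypothesis `hR` (`1 ≤ N_K` always). [folklore] -/
theorem boxUniform_sym_cell {A : Set G} (hA : ∀ g : G, g⁻¹ ∈ A ↔ g ∈ A) {K : ℕ} (hK : K ≤ P.m + P.K) (i : Fin P.d) :
    (towerRefl i K) ⁻¹' boxUniform P G A K 1 K =
      (towerTranslate K ((0 : Site P K).unshift i)) ⁻¹' boxUniform P G A K 1 K := by
  rw [← neg_axisVec_one]
  exact boxUniform_sym hA (Nat.one_le_iff_ne_zero.2 (P.sitesPerDir_ne_zero K)) hK i

end

end Summit.QuantumFields.BalabanUV.T4Continuum.HistoryRPTowerUniform
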